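import Literature.MathematicalPhysics.QuantumFieldTheory.Balaban1983to89.B6Axial2121TwoScaleV1

/-!
# `Balaban1983to89.B6StairStokesTorus` — T. Bałaban, *Propagators and renormalization transformations for lattice gauge
# theories. II*, Commun. Math. Phys. **96** (1984) 223–250 [Balaban1984PropagatorsII], p. 244, the identity behind (2.123): a bond
# value is a telescoping sum of plaquette variables along the tree — the DISCRETE STOKES FORMULA FOR THE CENTRED STAIRCASES
# `Γ_{y₀,x}` of the V1 torus calculus (`LatticeFieldCalculus.stairSum`), for every base point, direction and SIGNED run

statement-level skeleton of published theorems with citation tags; proofs where landed; nothing here is a claim about the Yang–Mills mass gap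

PDF held: `paper:balaban1984-cmp96-propagators-rt-ii` (journal page = PDF page + 222; p. 244 [PDF 22] read AS IMAGE on the ×4 render
`run/shared/lean/pub/pub-balaban/b2b-balaban-ref1/pages/1984-cmp96-propagators-rt-II/…-p022-x4.png`, 2026-08-21); [Balaban1984PropagatorsI]
(1.4), (1.7) p. 18 (plaquette variables, staircases).

PRINT (verbatim, p. 244).  *"Let us consider at first the bonds b ⊂ B(y), y ∈ Λ′. For b = ⟨x, x + e₂⟩, we have B(x, x + e₂) = (B(x, x + e₂) −
B(x − e₁, x − e₁ + e₂)) + … + (B((y₁ + 1, x₂, …, x_d), (y₁ + 1, x₂ + 1, …, x_d)) − B((y₁, x₂, …, x_d), (y₁, x₂ + 1, …, x_d))) = Σ(∂₁B)(p(x′)),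
the sum is over the plaquettes p(x′) determined by the points x′ ∈ [(y₁, x₂, …, x_d), x] and vectors e₁, e₂ … For arbitrary j, 2 ≤ j ≤ d, …
the plaquettes p(x′) are parallel to (e_{j−1}, e_j), …, (e₁, e_j)."*  (The printed identity uses the tree gauge B(Γ_{y,x}) = 0; the identity
below is its gauge-free form `B(b) = B(Γ_{y,x+e_μ}) − B(Γ_{y,x}) + Σ±(∂₁B)(p)`, for the CENTRED staircases of the V1 calculus — DIVERGENCE F3 —
whose runs are signed.)

CITATION HEADER (lean-in-tree rule) — WHAT IS REPRODUCED.  Phase-2 file of the `lit-balaban` typed skeleton (HOME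
`run/shared/lean/pub/lit-balaban/`), seat **p22 gen 11** (B6 fold owner r03, referee ref-4; lane = the Sect. C chain (2.95)–(2.147) on the
concrete two-scale data `tsV1`).  SKELETON rows **B6.Eq2.120 / B6.Txt@246** (first step (2.123) of the printed proof of *"(2.122) ≥ γ₀″‖B‖² on
(2.121)"*; decls of record untouched — b06's `…B6TreeGaugePoincare.bond_eq_sum_curl` is the CORNER-anchored ℤ^d identity; the sequel
`…B6Ineq2123CentredTorus` (same seat) turns the identity below into (2.123) for the centred trees).  THIS FILE, on the unit torus `T^{(j)}`:
* §1 `zsum g n` (def with body): the signed sum of `g : ℤ → V` over the integers between `0` and `n` (`zsum_add_one`; the discrete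
  antiderivative `eq_zsum_of_step`; `InRange`; the Cauchy–Schwarz bound `zsum_sq_le`);
* §2 `oc A ν μ s` (def with body): the plaquette variable at `s` for the ORDERED pair `(e_ν, e_μ)` — `= (∂₁A)(p)` for `ν < μ`, `= −(∂₁A)(p)` for
  `μ < ν` (`oc_eq_curl`, `oc_eq_neg_curl`, `oc_sq_eq`); `stepSite z ν t = z + te_ν`, `t ∈ ℤ`; **`runSum_shift_sub`**: two parallel signed runs differ
  by the two end rungs and the plaquettes between them, `A([z+e_μ, z+e_μ+ne_ν]) − A([z, z+ne_ν]) = A⟨z+ne_ν, μ⟩ − A⟨z, μ⟩ − Σ_t^{(n)} oc(z + te_ν)`;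
* §3 `lowMix k y₀ x` (def with body: the corners of `Γ_{y₀,x}`) and **`stairSum_shift_sub`** (the printed telescoping, centred, every signed
  displacement): if the `μ`-displacement does not wrap around the torus,
  `A(Γ_{y₀, x+e_μ}) − A(Γ_{y₀, x}) = A⟨x, μ⟩ − Σ_{ν<μ} Σ_t^{(x_ν−y₀,ν)} (∂₁A)(p_{ν,μ}(z_ν + te_ν))`, `z_ν` the corner at which the `ν`-run starts;
  `apply_eq_stairSum_sub_add` (the bond value solved for).
DEFINITIONS with bodies (`zsum`, `InRange`, `stepSite`, `oc`, `lowMix`) + THEOREMS; no `def … : Prop` fact; standard axioms.  HONEST SCOPE: pure lattice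
calculus on the finite tori of the V1 calculus (any `AddCommGroup`-valued bond function; unit lattice factor in `curl`); the no-wrap hypothesis is
explicit (inside a block it holds, sequel); NOT summit progress.
-/

noncomputable section

open scoped BigOperators

namespace Literature.MathematicalPhysics.QuantumFieldTheory.Balaban1983to89.B6StairStokesTorus

open LatticeFieldCalculus B6SectCTwoScaleV1
open B6Axial2121TwoScaleV1 (runSum_add_one)

variable {P : Params} {j : ℕ}

/-! ## §1  Signed sums over the integers between `0` and `n` -/

section ZSum

variable {V : Type*} [AddCommGroup V]

/-- the signed sum `Σ_t^{(n)} g(t)`: `g(0) + … + g(n−1)` for `n ≥ 0`, `−(g(−1) + … + g(n))` for `n < 0` — the discrete antiderivative of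
`g` vanishing at `0` (the shape of a signed straight run `A([x, x + ne_μ])`, [B5] (1.7)). [cite: Balaban1984PropagatorsI, (1.7) p.18] -/
def zsum (g : ℤ → V) : ℤ → V
  | (n : ℕ) => ∑ t ∈ Finset.range n, g t
  | Int.negSucc n => -∑ t ∈ Finset.range (n + 1), g (Int.negSucc t)

/-- the empty run contributes nothing. [cite: Balaban1984PropagatorsI, (1.7) p.18] -/
@[simp] theorem zsum_zero (g : ℤ → V) : zsum g 0 = 0 := by
  simp [zsum]

/-- unfolding for `n ≥ 0` (a forward run). [cite: Balaban1984PropagatorsI, (1.7) p.18] -/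
theorem zsum_ofNat (g : ℤ → V) (n : ℕ) : zsum g (n : ℤ) = ∑ t ∈ Finset.range n, g t := rfl

/-- unfolding for `n < 0` (a backward run, minus signs). [cite: Balaban1984PropagatorsI, (1.7) p.18] -/
theorem zsum_negSucc (g : ℤ → V) (n : ℕ) : zsum g (Int.negSucc n) = -∑ t ∈ Finset.range (n + 1), g (Int.negSucc t) := rfl

/-- **one more step**: `Σ^{(n+1)} g = Σ^{(n)} g + g(n)` for every `n ∈ ℤ` (cf. `runSum_add_one`). [cite: Balaban1984PropagatorsI, (1.7) p.18] -/
theorem zsum_add_one (g : ℤ → V) (n : ℤ) : zsum g (n + 1) = zsum g n + g n := by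
  cases n with
  | ofNat k =>
    rw [Int.ofNat_eq_natCast, ← Nat.cast_succ, zsum_ofNat, zsum_ofNat, Finset.sum_range_succ]
  | negSucc k =>
    cases k with
    | zero =>
      have e : Int.negSucc 0 + 1 = 0 := by decide
      rw [e, zsum_zero, zsum_negSucc, Finset.sum_range_one, neg_add_cancel]
    | succ k =>
      have e : Int.negSucc (k + 1) + 1 = Int.negSucc k := rfl
      rw [e, zsum_negSucc, zsum_negSucc, Finset.sum_range_succ _ (k + 1)]
      abel

/-- **the discrete antiderivative is unique**: a function on `ℤ` vanishing at `0` with increments `g` is `zsum g` (how a signed run is recognised). [cite: Balaban1984PropagatorsI, (1.7) p.18] -/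
theorem eq_zsum_of_step {G : ℤ → V} {g : ℤ → V} (h0 : G 0 = 0) (hs : ∀ t : ℤ, G (t + 1) = G t + g t) (n : ℤ) :
    G n = zsum g n := by
  induction n using Int.induction_on with
  | zero => rw [h0, zsum_zero]
  | succ i ih => rw [hs, ih, zsum_add_one]
  | pred i ih =>
    have h1 := hs (-(i : ℤ) - 1)
    have h2 := zsum_add_one g (-(i : ℤ) - 1)
    rw [sub_add_cancel] at h1 h2
    rw [ih] at h1
    exact add_right_cancel (h1.symm.trans h2)

/-- the integers between `0` and `n` (the steps of a signed run of length `n`, the support of `Σ^{(n)}`). [cite: Balaban1984PropagatorsI, (1.7) p.18] -/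
def InRange (n t : ℤ) : Prop := (0 ≤ t ∧ t < n) ∨ (n ≤ t ∧ t < 0)

/-- **Cauchy–Schwarz for a signed sum**: `|Σ^{(n)} g|² ≤ |n|²·M` when every summand that occurs has `g(t)² ≤ M` (the printed *"|B(x, x + e₂)|² ≤ |x₁ − y₁| Σ|(∂₁B)(p(x′))|²"*, cruder). [cite: Balaban1984PropagatorsII, (2.123) p.244] -/
theorem zsum_sq_le (g : ℤ → ℝ) (n : ℤ) {M : ℝ} (hM : ∀ t : ℤ, InRange n t → g t ^ 2 ≤ M) :
    zsum g n ^ 2 ≤ (n.natAbs : ℝ) ^ 2 * M := by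
  cases n with
  | ofNat k =>
    rw [Int.ofNat_eq_natCast, zsum_ofNat, Int.natAbs_natCast]
    have h1 := sq_sum_le_card_mul_sum_sq (s := Finset.range k) (f := fun t : ℕ => g t)
    rw [Finset.card_range] at h1
    have h2 : ∑ t ∈ Finset.range k, g t ^ 2 ≤ ∑ _t ∈ Finset.range k, M :=
      Finset.sum_le_sum fun t ht => hM t (Or.inl ⟨Int.natCast_nonneg t, by
        have := Finset.mem_range.1 ht
        show ((t : ℕ) : ℤ) < ((k : ℕ) : ℤ)
        exact_mod_cast this⟩)
    rw [Finset.sum_const, Finset.card_range, nsmul_eq_mul] at h2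
    calc (∑ t ∈ Finset.range k, g t) ^ 2 ≤ k * ∑ t ∈ Finset.range k, g t ^ 2 := h1
      _ ≤ k * (k * M) := mul_le_mul_of_nonneg_left h2 (Nat.cast_nonneg k)
      _ = (k : ℝ) ^ 2 * M := by ring
  | negSucc k =>
    rw [zsum_negSucc, neg_sq, Int.natAbs_negSucc]
    have h1 := sq_sum_le_card_mul_sum_sq (s := Finset.range (k + 1)) (f := fun t : ℕ => g (Int.negSucc t))
    rw [Finset.card_range] at h1
    have h2 : ∑ t ∈ Finset.range (k + 1), g (Int.negSucc t) ^ 2 ≤ ∑ _t ∈ Finset.range (k + 1), M :=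
      Finset.sum_le_sum fun t ht => hM (Int.negSucc t) (Or.inr ⟨by
        have := Finset.mem_range.1 ht
        rw [Int.negSucc_eq, Int.negSucc_eq]; omega, Int.negSucc_lt_zero t⟩)
    rw [Finset.sum_const, Finset.card_range, nsmul_eq_mul] at h2
    calc (∑ t ∈ Finset.range (k + 1), g (Int.negSucc t)) ^ 2 ≤ (k + 1 : ℕ) * ∑ t ∈ Finset.range (k + 1), g (Int.negSucc t) ^ 2 := h1
      _ ≤ (k + 1 : ℕ) * ((k + 1 : ℕ) * M) := mul_le_mul_of_nonneg_left h2 (Nat.cast_nonneg _)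
      _ = ((k + 1 : ℕ) : ℝ) ^ 2 * M := by ring

end ZSum

/-! ## §2  Oriented plaquette variables, integer run sites, and two parallel signed runs -/

section Runs

variable {V : Type*} [AddCommGroup V]

variable (P j) in
/-- `z + te_ν` for a signed number of steps `t ∈ ℤ` (the sites of a signed straight run). [cite: Balaban1984PropagatorsI, (1.7) p.18] -/
def stepSite (z : Site P j) (ν : Fin P.d) (t : ℤ) : Site P j := Function.update z ν (z ν + (t : ZMod (P.sitesPerDir j)))

/-- **the plaquette variable for an ORDERED pair of directions**: `oc A ν μ s = A⟨s, s+e_ν⟩ + A⟨s+e_ν, s+e_ν+e_μ⟩ − A⟨s+e_μ, s+e_μ+e_ν⟩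
− A⟨s, s+e_μ⟩` — the circulation of `A` around the plaquette at `s` spanned by `(e_ν, e_μ)` ([B5] (1.4); `= (∂₁A)(p)` for `ν < μ`, `= −(∂₁A)(p)`
for `μ < ν`). [cite: Balaban1984PropagatorsI, (1.4) p.18] -/
def oc (A : VecField P j V) (ν μ : Fin P.d) (s : Site P j) : V := A ⟨s, ν⟩ + A ⟨s.shift ν, μ⟩ - A ⟨s.shift μ, ν⟩ - A ⟨s, μ⟩

omit [AddCommGroup V] in
/-- for `ν < μ` the ordered plaquette variable IS the plaquette variable `(∂₁A)(p)` (unit lattice factor). [cite: Balaban1984PropagatorsI, (1.4) p.18] -/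
theorem oc_eq_curl {V : Type*} [AddCommGroup V] [Module ℝ V] (A : VecField P j V) {ν μ : Fin P.d} (h : ν < μ) (s : Site P j) :
    oc A ν μ s = curl 1 A ⟨s, ν, μ, h⟩ := by
  simp only [oc, curl, one_smul]

omit [AddCommGroup V] in
/-- for `μ < ν` it is MINUS the plaquette variable. [cite: Balaban1984PropagatorsI, (1.4) p.18] -/
theorem oc_eq_neg_curl {V : Type*} [AddCommGroup V] [Module ℝ V] (A : VecField P j V) {ν μ : Fin P.d} (h : μ < ν) (s : Site P j) :
    oc A ν μ s = -curl 1 A ⟨s, μ, ν, h⟩ := by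
  simp only [oc, curl, one_smul]
  abel

/-- either way its square is the square of a plaquette variable at `s`. [cite: Balaban1984PropagatorsI, (1.4) p.18] -/
theorem oc_sq_eq (A : VecField P j ℝ) {ν μ : Fin P.d} (h : ν ≠ μ) (s : Site P j) :
    ∃ p : Plaq P j, p.src = s ∧ oc A ν μ s ^ 2 = curl 1 A p ^ 2 := by
  rcases lt_or_gt_of_ne h with hlt | hgt
  · exact ⟨⟨s, ν, μ, hlt⟩, rfl, by rw [oc_eq_curl A hlt]⟩
  · exact ⟨⟨s, μ, ν, hgt⟩, rfl, by rw [oc_eq_neg_curl A hgt, neg_sq]⟩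

/-- zero steps. [cite: Balaban1984PropagatorsI, (1.7) p.18] -/
@[simp] theorem stepSite_zero (z : Site P j) (ν : Fin P.d) : stepSite P j z ν 0 = z := by
  simp [stepSite]

/-- one more step is a lattice translation. [cite: Balaban1984PropagatorsI, (1.7) p.18] -/
theorem stepSite_add_one (z : Site P j) (ν : Fin P.d) (t : ℤ) : stepSite P j z ν (t + 1) = (stepSite P j z ν t).shift ν := by
  funext κ
  by_cases hκ : κ = ν
  · subst hκ
    simp only [stepSite, Site.shift, Function.update_self]
    push_cast
    ring
  · simp only [stepSite, Site.shift, Function.update_of_ne hκ]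

/-- the coordinate `ν` of `z + te_ν`. [cite: Balaban1984PropagatorsI, (1.7) p.18] -/
theorem stepSite_apply_self (z : Site P j) (ν : Fin P.d) (t : ℤ) : stepSite P j z ν t ν = z ν + (t : ZMod (P.sitesPerDir j)) := by
  simp [stepSite]

/-- the other coordinates of `z + te_ν`. [cite: Balaban1984PropagatorsI, (1.7) p.18] -/
theorem stepSite_apply_ne (z : Site P j) {ν κ : Fin P.d} (h : κ ≠ ν) (t : ℤ) : stepSite P j z ν t κ = z κ := by
  simp [stepSite, Function.update_of_ne h]

/-- runs in the direction `ν` from `z` and from `z + e_μ` stay parallel. [cite: Balaban1984PropagatorsI, (1.7) p.18] -/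
theorem update_shift_eq_stepSite_shift (z : Site P j) {ν μ : Fin P.d} (hνμ : ν ≠ μ) (t : ℤ) :
    Function.update (z.shift μ) ν ((z.shift μ) ν + (t : ZMod (P.sitesPerDir j))) = (stepSite P j z ν t).shift μ := by
  funext κ
  by_cases hκν : κ = ν
  · subst hκν
    rw [Function.update_self]
    simp only [Site.shift, stepSite, Function.update_of_ne hνμ, Function.update_self]
  · rw [Function.update_of_ne hκν]
    by_cases hκμ : κ = μ
    · subst hκμ
      simp only [Site.shift, stepSite, Function.update_self, Function.update_of_ne (Ne.symm hνμ)]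
    · simp only [Site.shift, stepSite, Function.update_of_ne hκμ, Function.update_of_ne hκν]

/-- one more step of a signed straight run, in `stepSite` form. [cite: Balaban1984PropagatorsI, (1.7) p.18] -/
theorem runSum_add_one' (A : VecField P j V) (z : Site P j) (ν : Fin P.d) (n : ℤ) :
    runSum A z ν (n + 1) = runSum A z ν n + A ⟨stepSite P j z ν n, ν⟩ :=
  runSum_add_one A z ν n

/-- **two parallel signed runs differ by the two rungs and the plaquettes between them**:
`A([z+e_μ, z+e_μ+ne_ν]) − A([z, z+ne_ν]) = A⟨z+ne_ν, μ⟩ − A⟨z, μ⟩ − Σ_t^{(n)} oc A ν μ (z + te_ν)` for every signed length `n ∈ ℤ`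
(the discrete Stokes formula for a ladder of plaquettes; the inner rungs telescope away). [cite: Balaban1984PropagatorsII, (2.123) p.244] -/
theorem runSum_shift_sub (A : VecField P j V) (z : Site P j) {ν μ : Fin P.d} (hνμ : ν ≠ μ) (n : ℤ) :
    runSum A (z.shift μ) ν n - runSum A z ν n =
      A ⟨stepSite P j z ν n, μ⟩ - A ⟨z, μ⟩ - zsum (fun t => oc A ν μ (stepSite P j z ν t)) n := by
  have h0 : A ⟨stepSite P j z ν 0, μ⟩ - A ⟨z, μ⟩ - (runSum A (z.shift μ) ν 0 - runSum A z ν 0) = 0 := by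
    rw [stepSite_zero, runSum_zero, runSum_zero, sub_self, sub_self, sub_zero]
  have hs : ∀ t : ℤ, A ⟨stepSite P j z ν (t + 1), μ⟩ - A ⟨z, μ⟩ - (runSum A (z.shift μ) ν (t + 1) - runSum A z ν (t + 1))
      = (A ⟨stepSite P j z ν t, μ⟩ - A ⟨z, μ⟩ - (runSum A (z.shift μ) ν t - runSum A z ν t)) + oc A ν μ (stepSite P j z ν t) := by
    intro t
    rw [runSum_add_one' A z ν t, runSum_add_one, update_shift_eq_stepSite_shift z hνμ t, stepSite_add_one]
    simp only [oc]
    abel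
  have key := eq_zsum_of_step (G := fun m => A ⟨stepSite P j z ν m, μ⟩ - A ⟨z, μ⟩ - (runSum A (z.shift μ) ν m - runSum A z ν m))
    (g := fun t => oc A ν μ (stepSite P j z ν t)) h0 hs n
  rw [← key]
  abel

end Runs

/-! ## §3  The staircase to `x + e_μ` against the staircase to `x`: the printed telescoping, centred version -/

section Stair

variable {V : Type*} [AddCommGroup V]

variable (P j) in
/-- the hybrid point with the coordinates `< k` of `y₀` and the coordinates `≥ k` of `x` (the corners of `Γ_{y₀,x}`:
`lowMix (ν+1) y₀ x` is where the `ν`-run starts, `lowMix ν y₀ x` where it ends). [cite: Balaban1984PropagatorsI, (1.7) p.18] -/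
def lowMix (k : ℕ) (y₀ x : Site P j) : Site P j := fun κ => if (κ : ℕ) < k then y₀ κ else x κ

/-- `lowMix 0 y₀ x = x`: the staircase ends at `x`. [cite: Balaban1984PropagatorsI, (1.7) p.18] -/
@[simp] theorem lowMix_zero (y₀ x : Site P j) : lowMix P j 0 y₀ x = x := by
  funext κ
  simp [lowMix]

/-- the `ν`-run of `Γ_{y₀,x}` starts at `lowMix (ν+1) y₀ x`. [cite: Balaban1984PropagatorsI, (1.7) p.18] -/
theorem mixSite_eq_lowMix (ν : Fin P.d) (y₀ x : Site P j) : mixSite ν y₀ x = lowMix P j (ν + 1) y₀ x := by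
  funext κ
  simp only [mixSite, lowMix, Fin.lt_def]
  by_cases h : (ν : ℕ) < κ
  · rw [if_pos h, if_neg (by omega)]
  · rw [if_neg h, if_pos (by omega)]

/-- … and ends at `lowMix ν y₀ x`. [cite: Balaban1984PropagatorsI, (1.7) p.18] -/
theorem stepSite_mixSite_eq_lowMix (ν : Fin P.d) (y₀ x : Site P j) :
    stepSite P j (mixSite ν y₀ x) ν ((x ν - y₀ ν).valMinAbs) = lowMix P j ν y₀ x := by
  funext κ
  by_cases hκ : κ = ν
  · subst hκ
    rw [stepSite_apply_self, ZMod.coe_valMinAbs]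
    simp only [mixSite, lowMix, lt_irrefl, if_false]
    abel
  · rw [stepSite_apply_ne _ hκ]
    simp only [mixSite, lowMix, Fin.lt_def]
    have hne : (κ : ℕ) ≠ ν := fun h => hκ (Fin.ext h)
    by_cases h : (ν : ℕ) < κ
    · rw [if_pos h, if_neg (by omega)]
    · rw [if_neg h, if_pos (by omega)]

/-- a sum over the directions `ν < μ` of a function of `(ν : ℕ)` is a sum over `range μ`. [folklore] -/
private theorem sum_ite_lt_eq_sum_range (μ : Fin P.d) (F : ℕ → V) :
    ∑ ν : Fin P.d, (if ν < μ then F ν else 0) = ∑ k ∈ Finset.range μ, F k := by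
  have h1 : ∑ ν : Fin P.d, (if ν < μ then F ν else 0) = ∑ ν : Fin P.d, (if (ν : ℕ) < μ then F ν else 0) :=
    Finset.sum_congr rfl fun ν _ => by simp only [Fin.lt_def]
  rw [h1, Fin.sum_univ_eq_sum_range (fun k => if k < (μ : ℕ) then F k else 0), ← Finset.sum_filter]
  congr 1
  ext k
  simp only [Finset.mem_filter, Finset.mem_range]
  exact ⟨fun h => h.2, fun h => ⟨h.trans μ.isLt, h⟩⟩

/-- **the printed telescoping for the centred staircases** (p. 244, *"B(x, x + e₂) = (B(x, x + e₂) − B(x − e₁, x − e₁ + e₂)) + …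
= Σ(∂₁B)(p(x′))"*, here for an arbitrary base point `y₀`, every direction `μ` and SIGNED runs): if the `μ`-displacement of `x + e_μ` from `y₀`
is that of `x` plus one (no wrap-around), then
`A(Γ_{y₀, x+e_μ}) − A(Γ_{y₀, x}) = A⟨x, x+e_μ⟩ − Σ_{ν<μ} Σ_t^{(x_ν − y₀,ν)} oc A ν μ (z_ν + te_ν)`, `z_ν` the corner at which the `ν`-run of `Γ_{y₀,x}`
starts: the runs of directions `> μ` agree, the `μ`-run gains the bond `⟨lowMix μ, μ⟩`, each run of direction `ν < μ` is translated by `e_μ`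
(`runSum_shift_sub`) and the rungs telescope from `⟨x, μ⟩` down to `⟨lowMix μ, μ⟩`. [cite: Balaban1984PropagatorsII, (2.123) p.244] -/
theorem stairSum_shift_sub (A : VecField P j V) (y₀ x : Site P j) (μ : Fin P.d)
    (hwrap : ((x.shift μ) μ - y₀ μ).valMinAbs = (x μ - y₀ μ).valMinAbs + 1) :
    stairSum A y₀ (x.shift μ) - stairSum A y₀ x =
      A ⟨x, μ⟩ - ∑ ν ∈ Finset.univ.filter (fun ν : Fin P.d => ν < μ),
        zsum (fun t => oc A ν μ (stepSite P j (mixSite ν y₀ x) ν t)) ((x ν - y₀ ν).valMinAbs) := by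
  classical
  set x' := x.shift μ with hx'
  set Z : Fin P.d → V := fun ν => zsum (fun t => oc A ν μ (stepSite P j (mixSite ν y₀ x) ν t)) ((x ν - y₀ ν).valMinAbs) with hZ
  set D : Fin P.d → V := fun ν =>
    runSum A (mixSite ν y₀ x') ν ((x' ν - y₀ ν).valMinAbs) - runSum A (mixSite ν y₀ x) ν ((x ν - y₀ ν).valMinAbs) with hD
  have hsum : stairSum A y₀ x' - stairSum A y₀ x = ∑ ν, D ν := by
    unfold stairSum
    rw [← Finset.sum_sub_distrib]
  have hx'μ : x' μ = x μ + 1 := by simp [hx', Site.shift]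
  have hx'ne : ∀ κ, κ ≠ μ → x' κ = x κ := fun κ hκ => by simp [hx', Site.shift, Function.update_of_ne hκ]
  -- (a) the runs of directions `> μ` agree
  have hgt : ∀ ν, μ < ν → D ν = 0 := by
    intro ν hν
    have hmix : mixSite ν y₀ x' = mixSite ν y₀ x := by
      funext κ
      simp only [mixSite]
      split_ifs with h
      · exact hx'ne κ (ne_of_gt (hν.trans h))
      · rfl
    simp only [hD, hmix, hx'ne ν (ne_of_gt hν), sub_self]
  -- (b) the `μ`-run gains one bond
  have heq : D μ = A ⟨lowMix P j μ y₀ x, μ⟩ := by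
    have hmix : mixSite μ y₀ x' = mixSite μ y₀ x := by
      funext κ
      simp only [mixSite]
      split_ifs with h
      · exact hx'ne κ (ne_of_gt h)
      · rfl
    simp only [hD]
    rw [hx'μ] at hwrap
    rw [hmix, hx'μ, hwrap, runSum_add_one', add_sub_cancel_left, stepSite_mixSite_eq_lowMix]
  -- (c) the runs of directions `< μ` are translated by `e_μ`
  have hlt : ∀ ν, ν < μ → D ν = (A ⟨lowMix P j ν y₀ x, μ⟩ - A ⟨lowMix P j (ν + 1) y₀ x, μ⟩) - Z ν := by
    intro ν hν
    have hmix : mixSite ν y₀ x' = (mixSite ν y₀ x).shift μ := by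
      funext κ
      by_cases hκ : κ = μ
      · subst hκ
        simp only [mixSite, Site.shift, Function.update_self, if_pos hν, hx'μ]
      · simp only [mixSite, Site.shift, Function.update_of_ne hκ, hx'ne κ hκ]
    simp only [hD, hZ]
    rw [hmix, hx'ne ν (ne_of_lt hν), runSum_shift_sub A _ (ne_of_lt hν), stepSite_mixSite_eq_lowMix, mixSite_eq_lowMix ν y₀ x]
  -- (d) assembly
  rw [hsum]
  have hsplit : ∀ ν, D ν = (if ν < μ then D ν else 0) + ((if ν = μ then D ν else 0) + (if μ < ν then D ν else 0)) := by
    intro ν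
    rcases lt_trichotomy ν μ with h | h | h
    · rw [if_pos h, if_neg (ne_of_lt h), if_neg (not_lt_of_gt h), add_zero, add_zero]
    · subst h
      simp
    · rw [if_neg (not_lt_of_gt h), if_neg (ne_of_gt h), if_pos h, zero_add, zero_add]
  rw [Finset.sum_congr rfl (fun ν _ => hsplit ν), Finset.sum_add_distrib, Finset.sum_add_distrib, Finset.sum_ite_eq' Finset.univ μ D,
    if_pos (Finset.mem_univ μ)]
  have h3 : ∑ ν, (if μ < ν then D ν else 0) = 0 := Finset.sum_eq_zero fun ν _ => by
    split_ifs with h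
    · exact hgt ν h
    · rfl
  have h4 : ∑ ν, (if ν < μ then D ν else 0)
      = ∑ ν, (if ν < μ then (A ⟨lowMix P j ν y₀ x, μ⟩ - A ⟨lowMix P j (ν + 1) y₀ x, μ⟩) else 0) - ∑ ν, (if ν < μ then Z ν else 0) := by
    rw [← Finset.sum_sub_distrib]
    refine Finset.sum_congr rfl fun ν _ => ?_
    split_ifs with h
    · exact hlt ν h
    · rw [sub_zero]
  rw [h3, add_zero, h4, heq, sum_ite_lt_eq_sum_range μ (fun k => A ⟨lowMix P j k y₀ x, μ⟩ - A ⟨lowMix P j (k + 1) y₀ x, μ⟩),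
    Finset.sum_range_sub', lowMix_zero, ← Finset.sum_filter]
  abel

/-- **hence every bond value is a staircase difference plus signed plaquette sums** (same hypothesis).
[cite: Balaban1984PropagatorsII, (2.123) p.244] -/
theorem apply_eq_stairSum_sub_add (A : VecField P j V) (y₀ x : Site P j) (μ : Fin P.d)
    (hwrap : ((x.shift μ) μ - y₀ μ).valMinAbs = (x μ - y₀ μ).valMinAbs + 1) :
    A ⟨x, μ⟩ = (stairSum A y₀ (x.shift μ) - stairSum A y₀ x) + ∑ ν ∈ Finset.univ.filter (fun ν : Fin P.d => ν < μ),
        zsum (fun t => oc A ν μ (stepSite P j (mixSite ν y₀ x) ν t)) ((x ν - y₀ ν).valMinAbs) := by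
  rw [stairSum_shift_sub A y₀ x μ hwrap, sub_add_cancel]

end Stair

end Literature.MathematicalPhysics.QuantumFieldTheory.Balaban1983to89.B6StairStokesTorus

end
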